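import Literature.AlgebraicGeometry.Resolution.KollarBoundaryCentre
import Literature.AlgebraicGeometry.Resolution.StalkIdealLemmas
import HarnessLib

/-!
# Crux `PatchingRelPerfect` (stmt-ResolutionOfSingularities-16161), chain W5.2 — F7(β) (β-AX) X3 C-I (M2b-T), (T-f): THE NF CLAUSES AT THE
# STALK — carrier + member span a PRIME, and the product of the contact sections avoids it (`…DepthPhaseCContactNF`)

[OURS · L1 W5.2 · F7(β) (β-AX) X3 C-I (M2b-T) · res-L1-w52-plan-1 RULING G12-32 (iii) (𝒳-package input), hand res-D-repro-1 AS res-L1-repro-3]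
The algebra behind «no irreducible component of the contact surface `𝒳 = V(v) ∩ Z(Π_c φ_c)` lies in a member trace» (F-60΄s `hcomp`,
Sketch v20 §4.4 NF0/NF1, tri-2 20:28:01Z (4) / 20:38:00Z): in an snc family two DISTINCT members through `x` span a PRIME ideal of `𝒪_{X,x}`
(`HasSNC.isPrime_stalkIdeal_sup` — the quotient is regular along two members of one regular system of parameters), hence — NF1 entry by
entry, units for the entries not vanishing at `x` — the germ of the PRODUCT of the contact sections lies outside `(v_x) + T_x` for every
member `T ∋ x` other than the carrier (`germ_prod_not_mem_of_forall`); primality transports along open immersions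
(`isPrime_stalkIdeal_comap_iff`), so the statement is available on the patch `U` where the boundary clause lives.  Def-free; NOT a statement
of the manuscript under review; AI-written, weaker than expert review.  Literature files only; no fact, no sorry.

## References
* E. Bierstone, D. Grigoriev, P. Milman, J. Włodarczyk, *Effective Hironaka resolution …* (2011), Def. 3.1.1. [BierstoneGrigorievMilmanWlodarczyk2011]
* H. Matsumura, *Commutative Ring Theory* (1987), Thm. 14.2 (quotients by parts of a regular system of parameters). [Matsumura1987]
-/

-- `Summit.<Summit>.<Sub>.Theorems` with `Sub = Summit` (single-conjunct summit, D-0017)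
set_option linter.dupNamespace false

noncomputable section

open CategoryTheory AlgebraicGeometry TopologicalSpace IsLocalRing
open Literature.AlgebraicGeometry.Resolution
open Scheme.IdealSheafData

namespace Summit.ResolutionOfSingularities.ResolutionOfSingularities.Theorems

namespace ContactNF

universe u

variable {X : Scheme.{u}}

/-! ## §1 Two members of an snc family span a prime -/

/-- [OURS · L1 W5.2 · (M2b-T) (T-f)] **Two DISTINCT members of a simple normal crossings family through a point span a PRIME ideal of the
local ring** (they are two members of one regular system of parameters; Matsumura 14.2). [cite: Matsumura1987, Thm. 14.2]
[cite: BierstoneGrigorievMilmanWlodarczyk2011, Def. 3.1.1] -/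
theorem _root_.Literature.AlgebraicGeometry.Resolution.HasSNC.isPrime_stalkIdeal_sup {E : List X.IdealSheafData} (hE : HasSNC E)
    {D₁ D₂ : X.IdealSheafData} (h₁ : D₁ ∈ E) (h₂ : D₂ ∈ E) (hne : D₁ ≠ D₂) {x : X} (hx₁ : x ∈ D₁.support) (hx₂ : x ∈ D₂.support) :
    (stalkIdeal D₁ x ⊔ stalkIdeal D₂ x).IsPrime := by
  obtain ⟨hreg, u, hu, ⟨ι, hι, hιu⟩, -⟩ := hE x
  haveI := hreg
  let f : Fin 2 → Fin _ := ![ι ⟨D₁, h₁, hx₁⟩, ι ⟨D₂, h₂, hx₂⟩]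
  have hf : Function.Injective f := by
    intro a b hab
    fin_cases a <;> fin_cases b
    · rfl
    · exact absurd (congrArg Subtype.val (hι hab)) hne
    · exact absurd (congrArg Subtype.val (hι hab.symm)) hne
    · rfl
  have hz : IsRsopPart (u ∘ f) := isRsopPart_comp_of_rsop rfl u hu f hf
  have h := hz.isPrime_span_range
  have hr : Set.range (u ∘ f) = {u (ι ⟨D₁, h₁, hx₁⟩), u (ι ⟨D₂, h₂, hx₂⟩)} := by
    ext a
    simp only [Set.mem_range, Function.comp_apply, Set.mem_insert_iff, Set.mem_singleton_iff]
    constructor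
    · rintro ⟨i, rfl⟩
      fin_cases i
      · exact Or.inl rfl
      · exact Or.inr rfl
    · rintro (rfl | rfl)
      · exact ⟨0, rfl⟩
      · exact ⟨1, rfl⟩
  rw [hr, Ideal.span_insert] at h
  rwa [hιu ⟨D₁, h₁, hx₁⟩, hιu ⟨D₂, h₂, hx₂⟩]

/-! ## §2 A product of germs avoids a prime -/

/-- The germ of a product of sections is the product of the germs. [folklore] -/
theorem germ_list_prod (U : X.Opens) (x : X) (hx : x ∈ U) (l : List Γ(X, U)) :
    X.presheaf.germ U x hx l.prod = (l.map fun s => X.presheaf.germ U x hx s).prod := by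
  rw [← map_list_prod]

/-- [OURS · L1 W5.2 · (M2b-T) (T-f)] **A product of sections whose germs avoid a prime has germ outside the prime.** [folklore] -/
theorem germ_prod_not_mem_of_forall {U : X.Opens} {x : X} (hx : x ∈ U) {p : Ideal (X.presheaf.stalk x)} (hp : p.IsPrime)
    (l : List Γ(X, U)) (h : ∀ s ∈ l, X.presheaf.germ U x hx s ∉ p) : X.presheaf.germ U x hx l.prod ∉ p := by
  induction l with
  | nil => rw [List.prod_nil, map_one]; exact (Ideal.ne_top_iff_one p).mp hp.ne_top
  | cons s l ih =>
    rw [List.prod_cons, map_mul]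
    intro hmem
    rcases hp.mem_or_mem hmem with hs | hl
    · exact h s List.mem_cons_self hs
    · exact ih (fun t ht => h t (List.mem_cons_of_mem s ht)) hl

/-- [OURS · L1 W5.2 · (M2b-T) (T-f)] **NF at the stalk**: if every contact section either is a unit at `x` or satisfies NF1 for the member
`T ∋ x` — its germ lies outside `(v_x) + T_x` —, and `(v_x) + T_x` is prime, then the germ of the PRODUCT of the contact sections lies
outside `(v_x) + T_x` («the member trace `T ∩ G` is not a component of the contact surface at `x`»). [cite: Matsumura1987, Thm. 14.2] -/
theorem germ_prod_not_mem_carrier_sup_member {U : X.Opens} {x : X} (hx : x ∈ U) (v : Γ(X, U)) (T : X.IdealSheafData)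
    (hp : (Ideal.span {X.presheaf.germ U x hx v} ⊔ stalkIdeal T x).IsPrime) (l : List Γ(X, U))
    (hNF : ∀ s ∈ l, X.presheaf.germ U x hx s ∈ maximalIdeal (X.presheaf.stalk x) →
      X.presheaf.germ U x hx s ∉ Ideal.span {X.presheaf.germ U x hx v} ⊔ stalkIdeal T x) :
    X.presheaf.germ U x hx l.prod ∉ Ideal.span {X.presheaf.germ U x hx v} ⊔ stalkIdeal T x := by
  refine germ_prod_not_mem_of_forall hx hp l fun s hs hmem => ?_
  by_cases hsm : X.presheaf.germ U x hx s ∈ maximalIdeal (X.presheaf.stalk x)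
  · exact hNF s hs hsm hmem
  · exact hsm (le_maximalIdeal hp.ne_top hmem)

/-! ## §3 Primality along open immersions (the boundary clause lives on the patch `U`) -/

/-- [OURS · L1 W5.2 · (M2b-T) (T-f)] **Stalks of pulled-back ideal sheaves along an open immersion are the images under the stalk
isomorphism**; in particular primality is preserved and reflected. [folklore] -/
theorem isPrime_stalkIdeal_comap_iff {V X : Scheme.{u}} (j : V ⟶ X) [IsOpenImmersion j] (K : X.IdealSheafData) (y : V) :
    (stalkIdeal (K.comap j) y).IsPrime ↔ (stalkIdeal K (j y)).IsPrime := by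
  rw [stalkIdeal_comap_eq_map_stalkMap]
  let e : X.presheaf.stalk (j y) ≃+* V.presheaf.stalk y := (asIso (j.stalkMap y)).commRingCatIsoToRingEquiv
  change (Ideal.map (e : X.presheaf.stalk (j y) →+* V.presheaf.stalk y) (stalkIdeal K (j y))).IsPrime ↔ _
  constructor
  · intro h
    have h2 : (Ideal.comap (e : X.presheaf.stalk (j y) →+* V.presheaf.stalk y)
        (Ideal.map (e : X.presheaf.stalk (j y) →+* V.presheaf.stalk y) (stalkIdeal K (j y)))).IsPrime :=
      Ideal.comap_isPrime _ _
    have h3 : Ideal.comap (e : X.presheaf.stalk (j y) →+* V.presheaf.stalk y)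
        (Ideal.map (e : X.presheaf.stalk (j y) →+* V.presheaf.stalk y) (stalkIdeal K (j y))) = stalkIdeal K (j y) :=
      Ideal.comap_map_of_bijective (e : X.presheaf.stalk (j y) →+* V.presheaf.stalk y) e.bijective
    rwa [h3] at h2
  · intro h
    exact Ideal.map_isPrime_of_equiv e

end ContactNF

end Summit.ResolutionOfSingularities.ResolutionOfSingularities.Theorems

end
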